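/-
Origin: expansion seat `prover-pub-hodgecm-mc-sinst-1-g10-0`, handover #1249 2026-08-20T23:05Z md5 bf65e7989911 (436 l.; NEW additive leaf, ns HodgeCM.Model.ThetaDistFin: UfZero/UfOne (abbrev), finPairD/finPairDOne (+_apply), finCharZero/One (+_apply), finRepZero/One (+_apply), schwartzReindexCLM_apply_symm_apply, cmPairRep_finPair_tmul/cmPairRep_finPairOne_tmul, cmLineRepFin₀_finPair_tmul/cmLineRepFin₁_finPairOne_tmul, lineRepOf_zero/one_finToG_eq_adelicTensorEnd, lineRepOf_zero/one_one_finLineTorusIdeles_eq_adelicTensorEnd, tmul_left_cancel_fin, finRepZero/One_smooth; NAMES for audit: HodgeCM.Model.ThetaDistFin.lineRepOf_zero_finToG_eq_adelicTensorEnd · HodgeCM.Model.ThetaDistFin.lineRepOf_zero_one_finLineTorusIdeles_eq_adelicTensorEnd · HodgeCM.Model.ThetaDistFin.finRepZero_smooth) (`HOME/mc/pub-hodgecm-mc-sinst-1-g10/stage66/HodgeCM/Model/AdelicThetaDistributionFin.lean`, md5 bf65e7989911, 436 lines);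
landed by the second packager p2 gen 15 (p2-g15) in gate run 66 as `HodgeCM/Model/AdelicThetaDistributionFin.lean` (verbatim).
-/
/-
Copyright (c) 2026 the pub-hodgecm formalisation cell (harness21).  New file, not vendored.
Origin: session prover-pub-hodgecm-mc-sinst-1-g10-0 (unit pub-hodgecm-mc-sinst-1-g10, S-INSTANCE CONSTRUCTOR gen 10; the FINITE half of the honest
(J4) product Weil datum: the finite factor of the line representations `lineRepOf … k`, k = 0, 1, as operators `1 ⊗ ω_f`), 2026-08-20.
Intended final place: `HodgeCM/Model/AdelicThetaDistributionFin.lean` (NEW additive model-layer leaf; imports carch's `Model/ArchKTypeOfFinChar`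
(#CA26) and `Model/ArchKTypeOfTorus` (#CA60), theta-3's `Model/WeilCentralCoinvariants` (#S14 r2), sinst-1's `Model/AdelicThetaModuleFin` (#1238);
nothing imports it; drop alone).
-/
import Summits.HodgeConjecture.HodgeCM.Model.ArchKTypeOfFinChar
import Summits.HodgeConjecture.HodgeCM.Model.ArchKTypeOfTorus
import Summits.HodgeConjecture.HodgeCM.Model.WeilCentralCoinvariants_3
import Summits.HodgeConjecture.HodgeCM.Model.AdelicThetaModuleFin_2

set_option autoImplicit false

/-!
# The finite factor of the line representations: `lineRepOf k` at finite points is `1 ⊗ ω_{f,k}`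

For the character-generic S-side line representation `lineRepOf V S hGR hGR₀ hGR₁ hGR₂ hGR₃ η₀ η₁ η₂ η₃ k` (period-1 LAYER B; at
`archSideOf` it is `(P k).ω` by `archSideOf_P_ω`), k = 0 (§§ 1–2) and, with the same proofs, k = 1 (§§ 3–4, `One` names):
* `finRepZero … : Representation ℂ (U(V)(𝔸_f) × U(W₀)(𝔸_f)) 𝒮((𝔸_{L⁺}^∞)³)` — THE FINITE FACTOR: theta-3's `WeilCoinv.finPairRep` of the small pair
  `(U(diag frameD V), U(⟨a₀⟩))` at the compatible splitting `splittingOf hGR₀` ([GelbartRogawski1991, Prop. 3.1.1]), read on `Fin 3` through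
  `finSBReindex e₁`, pulled back along carch's frame transport `finFrameCongr` on the `U(V)`-member, and TWISTED by the scalar see-saw character
  `finCharZero = (η₀ · χ₀)` of the slot (tree `cmLineRepFin₀_apply_eq_smul_cmPairRep`);
* **`lineRepOf_zero_finToG_eq_adelicTensorEnd`**: `lineRepOf … 0 (finToG V hV g, 1) = 1 ⊗ finRepZero (g, 1)` — the field `fin_V` of
  `ThetaAdelicSide.ThetaDistDatum` (#1246) at the honest side (chain: carch `lineRepOf_zero_regime_finAdelicG` → tree Collapse → theta-3
  `pairRep_finPairToAdelic_piSBReindex_tmul` → tree `piSBReindex_tmul` / `linearMap_ext_tensor`);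
* **`lineRepOf_zero_one_finLineTorusIdeles_eq_adelicTensorEnd`**: `lineRepOf … 0 (1, finLineTorusIdeles u_f) = 1 ⊗ finRepZero (1, u_f)` — the field
  `fin_W` (carch #CA60 `lineRepOf_zero_one_finLineTorus`);
* **`finRepZero_smooth`**: every `Φ_f` is fixed under `finRepZero (·, 1)` by an OPEN subgroup of `U(V)(𝔸_f)` — the field `smooth` (tree
  `…cmLineRepFin₀_thinCosetTestFunₗ_eq_self` on the coset decomposition of `Φ_f`, read back on the finite factor through a nonzero `Φ_∞`).
KERNEL only: 0 records, 0 `def … : Prop`, nothing cited as a sentence; `#print axioms` ⊆ {propext, Classical.choice, Quot.sound}.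
-/

noncomputable section

open NumberField NumberField.mixedEmbedding IsDedekindDomain
open scoped Matrix TensorProduct Classical SchwartzMap
open Literature.NumberTheory.Automorphic Literature.NumberTheory.Weil1964
open Literature.NumberTheory.GelbartRogawski1991 Literature.NumberTheory.GelbartRogawski1991.UnitaryDualPair
open Literature.RepresentationTheory (SeesawScalar.twist SeesawScalar.twist_apply)
open HodgeCM.Adelic HodgeCM.PerL34 HodgeCM.Model.ArchSideTerm

namespace HodgeCM.Model
namespace ThetaDistFin

variable {L : CMField} {ι₁ : L →+* ℂ} (V : HermSpace3 L ι₁) (S : StubTree.SeesawDatum L)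
variable
  (hGR : (cmSplittingDatum (L : Type) finProdFinEquiv (frameD V) (frameD_real V) (frameD_ne V) (dW S) (dW_real S) (dW_ne S)).CompatibleSplitting)
  (hGR₀ : (cmSplittingDatum (L : Type) (e₁) (frameD V) (frameD_real V) (frameD_ne V) (lineVec (L : Type) (dW S 0))
    (fun _ => dW_real S 0) (fun _ => dW_ne S 0)).CompatibleSplitting)
  (hGR₁ : (cmSplittingDatum (L : Type) (e₁) (frameD V) (frameD_real V) (frameD_ne V) (lineVec (L : Type) (dW S 1))
    (fun _ => dW_real S 1) (fun _ => dW_ne S 1)).CompatibleSplitting)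
  (hGR₂ : (cmSplittingDatum (L : Type) (e₁) (frameD V) (frameD_real V) (frameD_ne V) (lineVec (L : Type) (dW' S 0))
    (fun _ => dW'_real S 0) (fun _ => dW'_ne S 0)).CompatibleSplitting)
  (hGR₃ : (cmSplittingDatum (L : Type) (e₁) (frameD V) (frameD_real V) (frameD_ne V) (lineVec (L : Type) (dW' S 1))
    (fun _ => dW'_real S 1) (fun _ => dW'_ne S 1)).CompatibleSplitting)
  (η₀ η₁ η₂ η₃ : CMAdelic (L : Type) (frameD V) × CMAdelicOne (L : Type) →* ℂˣ)
  (hV : IsAnisotropic L V.Hm)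

/-! ### § 1. The finite factor of slot 0 -/

/-- the finite `U(W₀)(𝔸_f)` of the framed line `⟨a₀⟩`, `a₀ = dW S 0`. -/
abbrev UfZero : Type :=
  ↥(UnitaryGroup.finAdelic (↥(maximalRealSubfield L)) (L : Type) (IsCMField.complexConj L) 1
    (Matrix.diagonal (lineVec (L : Type) (dW S 0))))

/-- the framed finite pair element of `(g, u_f)`: `((1, finFrameCongr g), (1, u_f))` in `U(diag frameD V)(𝔸) × U(⟨a₀⟩)(𝔸)`. -/
def finPairD : ↥V.adelicFin × UfZero S →*
    CMAdelic (L : Type) (frameD V) × CMAdelic (L : Type) (lineVec (L : Type) (dW S 0)) :=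
  (UnitaryGroup.finAdelicToAdelic (↥(maximalRealSubfield L)) (L : Type) (IsCMField.complexConj L) 3 (Matrix.diagonal (frameD V))).prodMap
      (UnitaryGroup.finAdelicToAdelic (↥(maximalRealSubfield L)) (L : Type) (IsCMField.complexConj L) 1
        (Matrix.diagonal (lineVec (L : Type) (dW S 0)))) |>.comp
    ((finFrameCongr (L : Type) V.Hm (frameG V) (frameD V) (frame_congr V)).prodMap (MonoidHom.id _))

/-- (Ported verbatim from the HodgeCMPerL package; no docstring in the source.) -/
@[simp] theorem finPairD_apply (g : ↥V.adelicFin) (u : UfZero S) :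
    finPairD V S (g, u) =
      (UnitaryGroup.finAdelicToAdelic (↥(maximalRealSubfield L)) (L : Type) (IsCMField.complexConj L) 3 (Matrix.diagonal (frameD V))
          (finFrameCongr (L : Type) V.Hm (frameG V) (frameD V) (frame_congr V) g),
        UnitaryGroup.finAdelicToAdelic (↥(maximalRealSubfield L)) (L : Type) (IsCMField.complexConj L) 1
          (Matrix.diagonal (lineVec (L : Type) (dW S 0))) u) := rfl

/-- **the scalar see-saw character of slot 0 on the finite pair**: `(g, u_f) ↦ η₀(v, t) · χ₀(v, t)` at `v = (1, finFrameCongr g)`,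
`t = finLineTorus u_f` (tree `cmLineRepFin₀_apply_eq_smul_cmPairRep`, carch `cmCenter_finLineTorus`). -/
def finCharZero : ↥V.adelicFin × UfZero S →* ℂˣ :=
  (η₀.comp
      (((UnitaryGroup.finAdelicToAdelic (↥(maximalRealSubfield L)) (L : Type) (IsCMField.complexConj L) 3
            (Matrix.diagonal (frameD V))).comp (finFrameCongr (L : Type) V.Hm (frameG V) (frameD V) (frame_congr V))).prodMap
        (finLineTorus (L : Type) (dW S 0) (dW_ne S 0)))) *
    (cmLineChar₀ (L : Type) finProdFinEquiv e₁ (frameD V) (frameD_real V) (frameD_ne V) (dW S) (dW_real S) (dW_ne S) hGR hGR₀ hGR₁).comp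
      (finPairD V S)

/-- (Ported verbatim from the HodgeCMPerL package; no docstring in the source.) -/
@[simp] theorem finCharZero_apply (g : ↥V.adelicFin) (u : UfZero S) :
    finCharZero V S hGR hGR₀ hGR₁ η₀ (g, u) =
      η₀ (UnitaryGroup.finAdelicToAdelic (↥(maximalRealSubfield L)) (L : Type) (IsCMField.complexConj L) 3 (Matrix.diagonal (frameD V))
            (finFrameCongr (L : Type) V.Hm (frameG V) (frameD V) (frame_congr V) g), finLineTorus (L : Type) (dW S 0) (dW_ne S 0) u) *
        cmLineChar₀ (L : Type) finProdFinEquiv e₁ (frameD V) (frameD_real V) (frameD_ne V) (dW S) (dW_real S) (dW_ne S) hGR hGR₀ hGR₁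
          (finPairD V S (g, u)) := rfl

/-- **THE FINITE FACTOR of slot 0**: `finCharZero • (R_{e₁}^f ∘ finPairRep (splittingOf hGR₀) (finFrameCongr g, u_f) ∘ (R_{e₁}^f)⁻¹)` on
`𝒮((𝔸_{L⁺}^∞)³)`. -/
def finRepZero : Representation ℂ (↥V.adelicFin × UfZero S) (FinSB (↥(maximalRealSubfield L)) (Fin 3)) :=
  Representation.congr (finSBReindex (↥(maximalRealSubfield L)) e₁)
    (SeesawScalar.twist (finCharZero V S hGR hGR₀ hGR₁ η₀)
      ((HodgeCM.WeilCoinv.finPairRep _ _ _ _ _ _ _ _ _ _ _ _ _ _ _ _ _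
          (splittingOf_isCompatible _ _ _ _ _ _ _ _ _ _ _ _ _ _ _ _ _ hGR₀)).comp
        ((finFrameCongr (L : Type) V.Hm (frameG V) (frameD V) (frame_congr V)).prodMap (MonoidHom.id (UfZero S)))))


/-- `finRepZero (g, u) Φ_f = finCharZero (g, u) • R_{e₁}^f (finPairRep (finFrameCongr g, u) ((R_{e₁}^f)⁻¹ Φ_f))`. -/
theorem finRepZero_apply (g : ↥V.adelicFin) (u : UfZero S) (Φf : FinSB (↥(maximalRealSubfield L)) (Fin 3)) :
    finRepZero V S hGR hGR₀ hGR₁ η₀ (g, u) Φf =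
      ((finCharZero V S hGR hGR₀ hGR₁ η₀ (g, u) : ℂˣ) : ℂ) •
        finSBReindex (↥(maximalRealSubfield L)) e₁
          (HodgeCM.WeilCoinv.finPairRep _ _ _ _ _ _ _ _ _ _ _ _ _ _ _ _ _
              (splittingOf_isCompatible _ _ _ _ _ _ _ _ _ _ _ _ _ _ _ _ _ hGR₀)
              (finFrameCongr (L : Type) V.Hm (frameG V) (frameD V) (frame_congr V) g, u)
            ((finSBReindex (↥(maximalRealSubfield L)) e₁).symm Φf)) := by
  conv_lhs => rw [← (finSBReindex (↥(maximalRealSubfield L)) e₁).apply_symm_apply Φf]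
  rw [finRepZero, Representation.congr_apply_apply, SeesawScalar.twist_apply, map_smul]
  rfl

omit hV in
/-- round trip of the archimedean reindexing. -/
theorem schwartzReindexCLM_apply_symm_apply {ι ι' : Type} [Fintype ι] [Fintype ι'] (e : ι ≃ ι')
    (φ : 𝓢((ι' → mixedSpace (↥(maximalRealSubfield L))), ℂ)) :
    schwartzReindexCLM (↥(maximalRealSubfield L)) e (schwartzReindexCLM (↥(maximalRealSubfield L)) e.symm φ) = φ := by
  ext w
  rw [schwartzReindexCLM_apply, schwartzReindexCLM_apply]
  exact congrArg φ (funext fun i => congrArg w (e.apply_symm_apply i))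

/-- **The small pair's Weil representation at a finite pair point, on `𝒮(𝔸³)`, is `1 ⊗ (R^f ∘ finPairRep ∘ (R^f)⁻¹)`** (theta-3 #S14r2
`pairRep_finPairToAdelic_piSBReindex_tmul` transported through the reindexing `e₁ : Fin 3 × Fin 1 ≃ Fin 3`). -/
theorem cmPairRep_finPair_tmul
    (p : ↥(UnitaryGroup.finAdelic (↥(maximalRealSubfield L)) (L : Type) (IsCMField.complexConj L) 3 (Matrix.diagonal (frameD V))) × UfZero S)
    (Φinf : 𝓢((Fin 3 → mixedSpace (↥(maximalRealSubfield L))), ℂ)) (Φf : FinSB (↥(maximalRealSubfield L)) (Fin 3)) :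
    cmPairRep (L : Type) e₁ (frameD V) (frameD_real V) (frameD_ne V) (lineVec (L : Type) (dW S 0)) (fun _ => dW_real S 0) (fun _ => dW_ne S 0)
        hGR₀ (HodgeCM.WeilCoinv.finPairToAdelic _ _ _ _ _ _ _ p)
        (piSchwartzBruhatEquiv (↥(maximalRealSubfield L)) (Fin 3) (Φinf ⊗ₜ[ℂ] Φf)) =
      piSchwartzBruhatEquiv (↥(maximalRealSubfield L)) (Fin 3)
        (Φinf ⊗ₜ[ℂ] finSBReindex (↥(maximalRealSubfield L)) e₁
          (HodgeCM.WeilCoinv.finPairRep _ _ _ _ _ _ _ _ _ _ _ _ _ _ _ _ _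
              (splittingOf_isCompatible _ _ _ _ _ _ _ _ _ _ _ _ _ _ _ _ _ hGR₀) p
            ((finSBReindex (↥(maximalRealSubfield L)) e₁).symm Φf))) := by
  have key := HodgeCM.WeilCoinv.pairRep_finPairToAdelic_piSBReindex_tmul _ _ _ _ _ _ _ _ _ _ _ _ _ _ _ _ _
    (splittingOf_isCompatible _ _ _ _ _ _ _ _ _ _ _ _ _ _ _ _ _ hGR₀) p
    (schwartzReindexCLM (↥(maximalRealSubfield L)) e₁.symm Φinf) ((finSBReindex (↥(maximalRealSubfield L)) e₁).symm Φf)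
  rw [piSBReindex_tmul, piSBReindex_tmul, schwartzReindexCLM_apply_symm_apply, LinearEquiv.apply_symm_apply] at key
  exact key

omit hV in
/-- **the twisted line representation at a framed finite `U(V)`-element, on pure tensors**: `ω₀″((1,k_f),1) (Φ_∞ ⊗ Φ_f) = Φ_∞ ⊗ finRepZero (g,1) Φ_f`,
`k_f = finFrameCongr g` (tree Collapse + theta-3 #S14r2). -/
theorem cmLineRepFin₀_finPair_tmul (g : ↥V.adelicFin) (Φinf : 𝓢((Fin 3 → mixedSpace (↥(maximalRealSubfield L))), ℂ))
    (Φf : FinSB (↥(maximalRealSubfield L)) (Fin 3)) :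
    cmLineRepFin₀ (L : Type) finProdFinEquiv e₁ (frameD V) (frameD_real V) (frameD_ne V) (dW S) (dW_real S) (dW_ne S) hGR hGR₀ hGR₁ η₀
        (UnitaryGroup.finAdelicToAdelic (↥(maximalRealSubfield L)) (L : Type) (IsCMField.complexConj L) 3 (Matrix.diagonal (frameD V))
          (finFrameCongr (L : Type) V.Hm (frameG V) (frameD V) (frame_congr V) g), 1)
        (piSchwartzBruhatEquiv (↥(maximalRealSubfield L)) (Fin 3) (Φinf ⊗ₜ[ℂ] Φf)) =
      piSchwartzBruhatEquiv (↥(maximalRealSubfield L)) (Fin 3) (Φinf ⊗ₜ[ℂ] finRepZero V S hGR hGR₀ hGR₁ η₀ (g, 1) Φf) := by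
  rw [cmLineRepFin₀_apply_eq_smul_cmPairRep, map_one, map_one, finRepZero_apply, TensorProduct.tmul_smul, map_smul]
  congr 1
  · -- the scalars
    rw [finCharZero_apply, finPairD_apply, map_one, map_one]
    rfl
  · -- the operators
    have h := cmPairRep_finPair_tmul V S hGR₀ (finFrameCongr (L : Type) V.Hm (frameG V) (frameD V) (frame_congr V) g, 1) Φinf Φf
    simp only [HodgeCM.WeilCoinv.finPairToAdelic_apply, map_one] at h
    exact h

/-- **`fin_V` for slot 0**: `lineRepOf … 0 (finToG V hV g, 1) = 1 ⊗ finRepZero (g, 1)` as operators on `𝒮(𝔸_{L⁺}³)`. -/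
theorem lineRepOf_zero_finToG_eq_adelicTensorEnd (g : ↥V.adelicFin) :
    lineRepOf V S hGR hGR₀ hGR₁ hGR₂ hGR₃ η₀ η₁ η₂ η₃ 0 (finToG V hV g, 1) =
      adelicTensorEnd (K := ↥(maximalRealSubfield L)) (ι := Fin 3) LinearMap.id (finRepZero V S hGR hGR₀ hGR₁ η₀ (g, 1)) := by
  apply linearMap_ext_tensor
  intro Φinf Φf
  rw [adelicTensorEnd_apply_tmul, LinearMap.id_apply, finToG_apply, cmAdelicProdEquiv_symm_one,
    lineRepOf_zero_regime_finAdelicG V S hGR hGR₀ hGR₁ hGR₂ hGR₃ η₀ η₁ η₂ η₃ hV g, cmLineRepFin₀_finPair_tmul]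

/-- **`fin_W` for slot 0**: `lineRepOf … 0 (1, finLineTorusIdeles u_f) = 1 ⊗ finRepZero (1, u_f)` as operators on `𝒮(𝔸_{L⁺}³)` (carch #CA60
`lineRepOf_zero_one_finLineTorus` + theta-3 #S14r2 at the pair point `(1, u_f)`). -/
theorem lineRepOf_zero_one_finLineTorusIdeles_eq_adelicTensorEnd (uf : UfZero S) :
    lineRepOf V S hGR hGR₀ hGR₁ hGR₂ hGR₃ η₀ η₁ η₂ η₃ 0 (1, finLineTorusIdeles (L : Type) (dW S 0) (dW_ne S 0) uf) =
      adelicTensorEnd (K := ↥(maximalRealSubfield L)) (ι := Fin 3) LinearMap.id (finRepZero V S hGR hGR₀ hGR₁ η₀ (1, uf)) := by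
  apply linearMap_ext_tensor
  intro Φinf Φf
  rw [adelicTensorEnd_apply_tmul, LinearMap.id_apply, lineRepOf_zero_one_finLineTorus, finRepZero_apply, TensorProduct.tmul_smul, map_smul]
  congr 1
  · -- the scalars
    rw [torusScalar_zero_applyG, finCharZero_apply, finPairD_apply, map_one, map_one, cmCenter_finLineTorus]
    rfl
  · -- the operators
    have h := cmPairRep_finPair_tmul V S hGR₀ (1, uf) Φinf Φf
    simp only [HodgeCM.WeilCoinv.finPairToAdelic_apply, map_one] at h
    rw [map_one]
    exact h

/-! ### § 2. Smoothness of the finite factor -/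

omit hV in
/-- cancelling a nonzero archimedean factor in a pure tensor. -/
theorem tmul_left_cancel_fin {Φ : 𝓢((Fin 3 → mixedSpace (↥(maximalRealSubfield L))), ℂ)} (hΦ : Φ ≠ 0)
    {a b : FinSB (↥(maximalRealSubfield L)) (Fin 3)} (h : Φ ⊗ₜ[ℂ] a = Φ ⊗ₜ[ℂ] b) : a = b := by
  obtain ⟨lam, hlam⟩ := Module.Projective.exists_dual_eq_one ℂ hΦ
  have h' := congrArg (fun x => TensorProduct.lid ℂ (FinSB (↥(maximalRealSubfield L)) (Fin 3)) (LinearMap.rTensor _ lam x)) h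
  simpa only [LinearMap.rTensor_tmul, hlam, TensorProduct.lid_tmul, one_smul] using h'

/-- **smoothness of the finite factor of slot 0**: every finite test function is fixed under `finRepZero (·, 1)` by an OPEN subgroup of
`U(V)(𝔸_f)` — the pull-back along `finFrameCongr` of a deep principal congruence level (tree `…cmLineRepFin₀_thinCosetTestFunₗ_eq_self`
[GelbartRogawski1991 §3.1 Remark p. 457; Weil1964 n° 41 Thm 6] through the coset decomposition `exists_eq_sum_smul_finTranslateSB_indicatorSB` of
`Φ_f`, read back on the finite factor by `fin_V` and a nonzero archimedean vector `Φ₀`). -/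
theorem finRepZero_smooth (hη₀c : Continuous fun p => ((η₀ p : ℂˣ) : ℂ))
    (h₁W : (∀ j, 0 < (ι₁ (dW S j)).re) ∨ ∀ j, (ι₁ (dW S j)).re < 0)
    {Φ₀ : 𝓢((Fin 3 → mixedSpace (↥(maximalRealSubfield L))), ℂ)} (hΦ₀ : Φ₀ ≠ 0) (Φf : FinSB (↥(maximalRealSubfield L)) (Fin 3)) :
    ∃ K : Subgroup ↥V.adelicFin, IsOpen (K : Set ↥V.adelicFin) ∧ ∀ g ∈ K, finRepZero V S hGR hGR₀ hGR₁ η₀ (g, 1) Φf = Φf := by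
  -- a level of `Φf` and its coset decomposition
  obtain ⟨𝔫, -, hlev⟩ := exists_level_of_mem_schwartzBruhat (↥(maximalRealSubfield L)) Φf.2
  obtain ⟨s, hs⟩ := exists_eq_sum_smul_finTranslateSB_indicatorSB (piLevelIdeal (↥(maximalRealSubfield L)) (Fin 3) 𝔫)
    (isOpen_piLevelIdeal (↥(maximalRealSubfield L)) 𝔫) (isCompact_piLevelIdeal (↥(maximalRealSubfield L)) (Fin 3) 𝔫) Φf hlev
  -- one deep level fixing every coset test function `Φ_∞ ⊗ 𝟙_{q + 𝔫𝒪̂³}`, `q ∈ s`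
  obtain ⟨n₀, hn₀, hfix⟩ :=
    exists_nat_forall_dvd_finCongruenceLevel_forall_cmLineRepFin₀_thinCosetTestFunₗ_eq_self (L : Type) finProdFinEquiv e₁
      (frameD V) (frameD_real V) (frameD_ne V) (dW S) (dW_real S) (dW_ne S) hGR hGR₀ hGR₁ η₀
      (hasThetaMajorants_cmPairSplitting_of_signs_two (L : Type) finProdFinEquiv (frameD V) (frameD_real V) (frameD_ne V) (dW S)
        (dW_real S) (dW_ne S) ι₁ hGR (frameD_sign_ι₁' V) h₁W (frameD_sign_of_ne V))
      (hasThetaMajorants_omega_pairSmall₁_lineVec_of_signs (L : Type) e₁ (frameD V) (frameD_real V) (frameD_ne V) (dW S 0)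
        (dW_real S 0) (dW_ne S 0) hGR₀ ι₁ (frameD_sign_ι₁' V) (frameD_sign_of_ne V))
      (hasThetaMajorants_omega_pairSmall₂_lineVec_of_signs (L : Type) e₁ (frameD V) (frameD_real V) (frameD_ne V) (dW S 1)
        (dW_real S 1) (dW_ne S 1) hGR₁ ι₁ (frameD_sign_ι₁' V) (frameD_sign_of_ne V))
      hη₀c (A := ↥s) (fun q => (q.1.out : Fin 3 → FiniteAdeleRing (𝓞 ↥(maximalRealSubfield L)) ↥(maximalRealSubfield L)))
      (fun _ => 𝔫)
  have hlvl : Ideal.span {((n₀ : ℕ) : 𝓞 (L : Type))} ≠ 0 := span_natCast_ne_zero (L := L) hn₀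
  refine ⟨(UnitaryGroup.finCongruenceLevel (↥(maximalRealSubfield L)) (L : Type) (IsCMField.complexConj L) 3 (Matrix.diagonal (frameD V))
      (Ideal.span {((n₀ : ℕ) : 𝓞 (L : Type))})).comap (finFrameCongr (L : Type) V.Hm (frameG V) (frameD V) (frame_congr V)), ?_, ?_⟩
  · rw [Subgroup.coe_comap]
    exact (UnitaryGroup.isOpen_finCongruenceLevel (F := ↥(maximalRealSubfield L)) (E := (L : Type)) (c := IsCMField.complexConj L)
      (N := 3) (J := Matrix.diagonal (frameD V)) hlvl).preimage (continuous_finFrameCongr (L : Type) V.Hm (frameG V) (frameD V) (frame_congr V))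
  · intro g hg
    have hq : ∀ q ∈ s, finRepZero V S hGR hGR₀ hGR₁ η₀ (g, 1)
        (cosetIndicatorSB (↥(maximalRealSubfield L)) (Fin 3) (q.out : Fin 3 → FiniteAdeleRing (𝓞 ↥(maximalRealSubfield L)) _) 𝔫) =
        cosetIndicatorSB (↥(maximalRealSubfield L)) (Fin 3) (q.out : Fin 3 → FiniteAdeleRing (𝓞 ↥(maximalRealSubfield L)) _) 𝔫 := by
      intro q hqs
      have h := hfix n₀ hn₀ (dvd_refl _) _ (Subgroup.mem_comap.mp hg) ⟨q, hqs⟩ Φ₀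
      rw [thinCosetTestFunₗ_eq_tmul_cosetIndicatorSB, cmLineRepFin₀_finPair_tmul] at h
      exact tmul_left_cancel_fin hΦ₀ ((piSchwartzBruhatEquiv (↥(maximalRealSubfield L)) (Fin 3)).injective h)
    have hs' : Φf = ∑ q ∈ s, ((Φf : (Fin 3 → FiniteAdeleRing (𝓞 ↥(maximalRealSubfield L)) ↥(maximalRealSubfield L)) → ℂ) q.out) •
        cosetIndicatorSB (↥(maximalRealSubfield L)) (Fin 3) (q.out : Fin 3 → FiniteAdeleRing (𝓞 ↥(maximalRealSubfield L)) _) 𝔫 := hs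
    calc finRepZero V S hGR hGR₀ hGR₁ η₀ (g, 1) Φf
        = finRepZero V S hGR hGR₀ hGR₁ η₀ (g, 1)
            (∑ q ∈ s, ((Φf : (Fin 3 → FiniteAdeleRing (𝓞 ↥(maximalRealSubfield L)) ↥(maximalRealSubfield L)) → ℂ) q.out) •
              cosetIndicatorSB (↥(maximalRealSubfield L)) (Fin 3) (q.out : Fin 3 → FiniteAdeleRing (𝓞 ↥(maximalRealSubfield L)) _) 𝔫) := by
          rw [← hs']
      _ = ∑ q ∈ s, ((Φf : (Fin 3 → FiniteAdeleRing (𝓞 ↥(maximalRealSubfield L)) ↥(maximalRealSubfield L)) → ℂ) q.out) •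
              cosetIndicatorSB (↥(maximalRealSubfield L)) (Fin 3) (q.out : Fin 3 → FiniteAdeleRing (𝓞 ↥(maximalRealSubfield L)) _) 𝔫 := by
          rw [map_sum]
          exact Finset.sum_congr rfl fun q hq' => by rw [map_smul, hq q hq']
      _ = Φf := hs'.symm

/-! ### § 3. The finite factor of slot 1 -/

/-- the finite `U(W₀)(𝔸_f)` of the framed line `⟨a₁⟩`, `a₀ = dW S 1`. -/
abbrev UfOne : Type :=
  ↥(UnitaryGroup.finAdelic (↥(maximalRealSubfield L)) (L : Type) (IsCMField.complexConj L) 1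
    (Matrix.diagonal (lineVec (L : Type) (dW S 1))))

/-- the framed finite pair element of `(g, u_f)`: `((1, finFrameCongr g), (1, u_f))` in `U(diag frameD V)(𝔸) × U(⟨a₁⟩)(𝔸)`. -/
def finPairDOne : ↥V.adelicFin × UfOne S →*
    CMAdelic (L : Type) (frameD V) × CMAdelic (L : Type) (lineVec (L : Type) (dW S 1)) :=
  (UnitaryGroup.finAdelicToAdelic (↥(maximalRealSubfield L)) (L : Type) (IsCMField.complexConj L) 3 (Matrix.diagonal (frameD V))).prodMap
      (UnitaryGroup.finAdelicToAdelic (↥(maximalRealSubfield L)) (L : Type) (IsCMField.complexConj L) 1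
        (Matrix.diagonal (lineVec (L : Type) (dW S 1)))) |>.comp
    ((finFrameCongr (L : Type) V.Hm (frameG V) (frameD V) (frame_congr V)).prodMap (MonoidHom.id _))

/-- (Ported verbatim from the HodgeCMPerL package; no docstring in the source.) -/
@[simp] theorem finPairDOne_apply (g : ↥V.adelicFin) (u : UfOne S) :
    finPairDOne V S (g, u) =
      (UnitaryGroup.finAdelicToAdelic (↥(maximalRealSubfield L)) (L : Type) (IsCMField.complexConj L) 3 (Matrix.diagonal (frameD V))
          (finFrameCongr (L : Type) V.Hm (frameG V) (frameD V) (frame_congr V) g),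
        UnitaryGroup.finAdelicToAdelic (↥(maximalRealSubfield L)) (L : Type) (IsCMField.complexConj L) 1
          (Matrix.diagonal (lineVec (L : Type) (dW S 1))) u) := rfl

/-- **the scalar see-saw character of slot 1 on the finite pair**: `(g, u_f) ↦ η₀(v, t) · χ₀(v, t)` at `v = (1, finFrameCongr g)`,
`t = finLineTorus u_f` (tree `cmLineRepFin₁_apply_eq_smul_cmPairRep`, carch `cmCenter_finLineTorus`). -/
def finCharOne : ↥V.adelicFin × UfOne S →* ℂˣ :=
  (η₁.comp
      (((UnitaryGroup.finAdelicToAdelic (↥(maximalRealSubfield L)) (L : Type) (IsCMField.complexConj L) 3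
            (Matrix.diagonal (frameD V))).comp (finFrameCongr (L : Type) V.Hm (frameG V) (frameD V) (frame_congr V))).prodMap
        (finLineTorus (L : Type) (dW S 1) (dW_ne S 1)))) *
    (cmLineChar₁ (L : Type) finProdFinEquiv e₁ (frameD V) (frameD_real V) (frameD_ne V) (dW S) (dW_real S) (dW_ne S) hGR hGR₀ hGR₁).comp
      (finPairDOne V S)

/-- (Ported verbatim from the HodgeCMPerL package; no docstring in the source.) -/
@[simp] theorem finCharOne_apply (g : ↥V.adelicFin) (u : UfOne S) :
    finCharOne V S hGR hGR₀ hGR₁ η₁ (g, u) =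
      η₁ (UnitaryGroup.finAdelicToAdelic (↥(maximalRealSubfield L)) (L : Type) (IsCMField.complexConj L) 3 (Matrix.diagonal (frameD V))
            (finFrameCongr (L : Type) V.Hm (frameG V) (frameD V) (frame_congr V) g), finLineTorus (L : Type) (dW S 1) (dW_ne S 1) u) *
        cmLineChar₁ (L : Type) finProdFinEquiv e₁ (frameD V) (frameD_real V) (frameD_ne V) (dW S) (dW_real S) (dW_ne S) hGR hGR₀ hGR₁
          (finPairDOne V S (g, u)) := rfl

/-- **THE FINITE FACTOR of slot 1**: `finCharOne • (R_{e₁}^f ∘ finPairRep (splittingOf hGR₁) (finFrameCongr g, u_f) ∘ (R_{e₁}^f)⁻¹)` on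
`𝒮((𝔸_{L⁺}^∞)³)`. -/
def finRepOne : Representation ℂ (↥V.adelicFin × UfOne S) (FinSB (↥(maximalRealSubfield L)) (Fin 3)) :=
  Representation.congr (finSBReindex (↥(maximalRealSubfield L)) e₁)
    (SeesawScalar.twist (finCharOne V S hGR hGR₀ hGR₁ η₁)
      ((HodgeCM.WeilCoinv.finPairRep _ _ _ _ _ _ _ _ _ _ _ _ _ _ _ _ _
          (splittingOf_isCompatible _ _ _ _ _ _ _ _ _ _ _ _ _ _ _ _ _ hGR₁)).comp
        ((finFrameCongr (L : Type) V.Hm (frameG V) (frameD V) (frame_congr V)).prodMap (MonoidHom.id (UfOne S)))))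


/-- `finRepOne (g, u) Φ_f = finCharOne (g, u) • R_{e₁}^f (finPairRep (finFrameCongr g, u) ((R_{e₁}^f)⁻¹ Φ_f))`. -/
theorem finRepOne_apply (g : ↥V.adelicFin) (u : UfOne S) (Φf : FinSB (↥(maximalRealSubfield L)) (Fin 3)) :
    finRepOne V S hGR hGR₀ hGR₁ η₁ (g, u) Φf =
      ((finCharOne V S hGR hGR₀ hGR₁ η₁ (g, u) : ℂˣ) : ℂ) •
        finSBReindex (↥(maximalRealSubfield L)) e₁
          (HodgeCM.WeilCoinv.finPairRep _ _ _ _ _ _ _ _ _ _ _ _ _ _ _ _ _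
              (splittingOf_isCompatible _ _ _ _ _ _ _ _ _ _ _ _ _ _ _ _ _ hGR₁)
              (finFrameCongr (L : Type) V.Hm (frameG V) (frameD V) (frame_congr V) g, u)
            ((finSBReindex (↥(maximalRealSubfield L)) e₁).symm Φf)) := by
  conv_lhs => rw [← (finSBReindex (↥(maximalRealSubfield L)) e₁).apply_symm_apply Φf]
  rw [finRepOne, Representation.congr_apply_apply, SeesawScalar.twist_apply, map_smul]
  rfl

/-- **The small pair's Weil representation at a finite pair point, on `𝒮(𝔸³)`, is `1 ⊗ (R^f ∘ finPairRep ∘ (R^f)⁻¹)`** (theta-3 #S14r2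
`pairRep_finPairToAdelic_piSBReindex_tmul` transported through the reindexing `e₁ : Fin 3 × Fin 1 ≃ Fin 3`). -/
theorem cmPairRep_finPairOne_tmul
    (p : ↥(UnitaryGroup.finAdelic (↥(maximalRealSubfield L)) (L : Type) (IsCMField.complexConj L) 3 (Matrix.diagonal (frameD V))) × UfOne S)
    (Φinf : 𝓢((Fin 3 → mixedSpace (↥(maximalRealSubfield L))), ℂ)) (Φf : FinSB (↥(maximalRealSubfield L)) (Fin 3)) :
    cmPairRep (L : Type) e₁ (frameD V) (frameD_real V) (frameD_ne V) (lineVec (L : Type) (dW S 1)) (fun _ => dW_real S 1) (fun _ => dW_ne S 1)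
         hGR₁ (HodgeCM.WeilCoinv.finPairToAdelic _ _ _ _ _ _ _ p)
        (piSchwartzBruhatEquiv (↥(maximalRealSubfield L)) (Fin 3) (Φinf ⊗ₜ[ℂ] Φf)) =
      piSchwartzBruhatEquiv (↥(maximalRealSubfield L)) (Fin 3)
        (Φinf ⊗ₜ[ℂ] finSBReindex (↥(maximalRealSubfield L)) e₁
          (HodgeCM.WeilCoinv.finPairRep _ _ _ _ _ _ _ _ _ _ _ _ _ _ _ _ _
              (splittingOf_isCompatible _ _ _ _ _ _ _ _ _ _ _ _ _ _ _ _ _ hGR₁) p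
            ((finSBReindex (↥(maximalRealSubfield L)) e₁).symm Φf))) := by
  have key := HodgeCM.WeilCoinv.pairRep_finPairToAdelic_piSBReindex_tmul _ _ _ _ _ _ _ _ _ _ _ _ _ _ _ _ _
    (splittingOf_isCompatible _ _ _ _ _ _ _ _ _ _ _ _ _ _ _ _ _ hGR₁) p
    (schwartzReindexCLM (↥(maximalRealSubfield L)) e₁.symm Φinf) ((finSBReindex (↥(maximalRealSubfield L)) e₁).symm Φf)
  rw [piSBReindex_tmul, piSBReindex_tmul, schwartzReindexCLM_apply_symm_apply, LinearEquiv.apply_symm_apply] at key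
  exact key

omit hV in
/-- **the twisted line representation at a framed finite `U(V)`-element, on pure tensors**: `ω₁″((1,k_f),1) (Φ_∞ ⊗ Φ_f) = Φ_∞ ⊗ finRepOne (g,1) Φ_f`,
`k_f = finFrameCongr g` (tree Collapse + theta-3 #S14r2). -/
theorem cmLineRepFin₁_finPairOne_tmul (g : ↥V.adelicFin) (Φinf : 𝓢((Fin 3 → mixedSpace (↥(maximalRealSubfield L))), ℂ))
    (Φf : FinSB (↥(maximalRealSubfield L)) (Fin 3)) :
    cmLineRepFin₁ (L : Type) finProdFinEquiv e₁ (frameD V) (frameD_real V) (frameD_ne V) (dW S) (dW_real S) (dW_ne S) hGR hGR₀ hGR₁ η₁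
        (UnitaryGroup.finAdelicToAdelic (↥(maximalRealSubfield L)) (L : Type) (IsCMField.complexConj L) 3 (Matrix.diagonal (frameD V))
          (finFrameCongr (L : Type) V.Hm (frameG V) (frameD V) (frame_congr V) g), 1)
        (piSchwartzBruhatEquiv (↥(maximalRealSubfield L)) (Fin 3) (Φinf ⊗ₜ[ℂ] Φf)) =
      piSchwartzBruhatEquiv (↥(maximalRealSubfield L)) (Fin 3) (Φinf ⊗ₜ[ℂ] finRepOne V S hGR hGR₀ hGR₁ η₁ (g, 1) Φf) := by
  rw [cmLineRepFin₁_apply_eq_smul_cmPairRep, map_one, map_one, finRepOne_apply, TensorProduct.tmul_smul, map_smul]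
  congr 1
  · -- the scalars
    rw [finCharOne_apply, finPairDOne_apply, map_one, map_one]
    rfl
  · -- the operators
    have h := cmPairRep_finPairOne_tmul V S  hGR₁ (finFrameCongr (L : Type) V.Hm (frameG V) (frameD V) (frame_congr V) g, 1) Φinf Φf
    simp only [HodgeCM.WeilCoinv.finPairToAdelic_apply, map_one] at h
    exact h

/-- **`fin_V` for slot 1**: `lineRepOf … 1 (finToG V hV g, 1) = 1 ⊗ finRepOne (g, 1)` as operators on `𝒮(𝔸_{L⁺}³)`. -/
theorem lineRepOf_one_finToG_eq_adelicTensorEnd (g : ↥V.adelicFin) :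
    lineRepOf V S hGR hGR₀ hGR₁ hGR₂ hGR₃ η₀ η₁ η₂ η₃ 1 (finToG V hV g, 1) =
      adelicTensorEnd (K := ↥(maximalRealSubfield L)) (ι := Fin 3) LinearMap.id (finRepOne V S hGR hGR₀ hGR₁ η₁ (g, 1)) := by
  apply linearMap_ext_tensor
  intro Φinf Φf
  rw [adelicTensorEnd_apply_tmul, LinearMap.id_apply, finToG_apply, cmAdelicProdEquiv_symm_one,
    lineRepOf_one_regime_finAdelicG V S hGR hGR₀ hGR₁ hGR₂ hGR₃ η₀ η₁ η₂ η₃ hV g, cmLineRepFin₁_finPairOne_tmul]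

/-- **`fin_W` for slot 1**: `lineRepOf … 1 (1, finLineTorusIdeles u_f) = 1 ⊗ finRepOne (1, u_f)` as operators on `𝒮(𝔸_{L⁺}³)` (carch #CA60
`lineRepOf_one_one_finLineTorus` + theta-3 #S14r2 at the pair point `(1, u_f)`). -/
theorem lineRepOf_one_one_finLineTorusIdeles_eq_adelicTensorEnd (uf : UfOne S) :
    lineRepOf V S hGR hGR₀ hGR₁ hGR₂ hGR₃ η₀ η₁ η₂ η₃ 1 (1, finLineTorusIdeles (L : Type) (dW S 1) (dW_ne S 1) uf) =
      adelicTensorEnd (K := ↥(maximalRealSubfield L)) (ι := Fin 3) LinearMap.id (finRepOne V S hGR hGR₀ hGR₁ η₁ (1, uf)) := by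
  apply linearMap_ext_tensor
  intro Φinf Φf
  rw [adelicTensorEnd_apply_tmul, LinearMap.id_apply, lineRepOf_one_one_finLineTorus, finRepOne_apply, TensorProduct.tmul_smul, map_smul]
  congr 1
  · -- the scalars
    rw [torusScalar_one_applyG, finCharOne_apply, finPairDOne_apply, map_one, map_one, cmCenter_finLineTorus]
    rfl
  · -- the operators
    have h := cmPairRep_finPairOne_tmul V S  hGR₁ (1, uf) Φinf Φf
    simp only [HodgeCM.WeilCoinv.finPairToAdelic_apply, map_one] at h
    rw [map_one]
    exact h


-- port_pkg: scope closed for this part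
end ThetaDistFin
end HodgeCM.Model
end
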